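import Mathlib
import HarnessLib
import Literature.Computability.AlgebraicComplexity.PatternExpressions
import Literature.Computability.AlgebraicComplexity.ValiantClasses
import Literature.Computability.AlgebraicComplexity.ValiantClassesProofs
import Literature.Computability.AlgebraicComplexity.QPBoundedClosure
import Summits.ValiantsHypothesis.ValiantsHypothesis.Theses.MonotoneRestoration
import Summits.ValiantsHypothesis.ValiantsHypothesis.Theorems.SymmetryDialPlumbing
import Summits.ValiantsHypothesis.ValiantsHypothesis.Theorems.MonotoneRestorationMonotoneRestorationQPZetaPatterns

/-!
# Route MonotoneRestoration — aside `OrbitCompressionQP` (stmt-ValiantsHypothesis-18332), line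
# `expression_compression`: quasi-polynomial SIZE (symmetric) circuits and narrow quasi-polynomial-length
# expressions force `VQP` — the conclusion classes of the crux and of `stub_narrowExpressionCompression`
# sit inside `VQP`

Helper file (`--supports stmt-ValiantsHypothesis-18332`), def-free.  The repair census of the `-3` hands
(g2, 2026-08-31) lists as a missing M–L tool "LabelledArithCircuit → ArithCircuit/complexity bridge
(topological sort + fan-in binarisation) ⇒ NQP ⊆ VQP via ζ-P".  That bridge IS ALREADY A THEOREM OF THE TREE:
`SymmetryDialPlumbing.complexity_eval_le` (route `SymmetryDial`, item stmt-ValiantsHypothesis-23682):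
every gate of a Dawar–Wilsenach labelled circuit on a finite gate set `G` has fan-in-two complexity
`≤ |G|²`.  This file records the consequences for the present aside, in its registered currencies:

* `isQPBounded_complexity_of_qpSize` — a family computed, level by level, by labelled circuits with
  `≤ 2^((log₂ n + c)^c)` gates (symmetric or not) has quasi-polynomially bounded complexity;
  `isQPBounded_complexity_of_qpSymmetricSize` — the same for the CONCLUSION of `OrbitCompressionQP` verbatim
  (square-symmetric circuits of quasi-polynomial SIZE); `isVQPFamily_of_qpSymmetricSize` — hence `VQP` for
  p-families;
* `isQPBounded_complexity_of_narrowQP`, `isVQPFamily_of_narrowQP` — **NQP ⊆ VQP**: the conclusion class of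
  `stub_narrowExpressionCompression` (closed labelled pattern expressions with `n^(k+l) ≤ 2^((log₂ n + c)^c)`
  labels and length `≤ 2^((log₂ n + c)^c)`, "NQP") consists of families of quasi-polynomially bounded
  complexity (THEOREM ζ-P `Theorems.qpSymmetric_patternExpr` builds the circuit, the bridge bounds its
  complexity), hence of `VQP` families as soon as the degree is p-bounded;
* `matrixSymmetric_of_narrowQP`, `narrow_of_narrowQP` — the other two features of NQP families (closed
  expressions are matrix-symmetric, `PatternExpr.rename_perm_close`; dropping the length bound);
* `narrowQP_iff_of_vqpCompression` — consequently the `VQP` FORM of the open stub ("matrix-symmetric `VQP`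
  families with narrow expressions of some length are NQP", which implies the registered stub,
  `stub_narrowExpressionCompression_of_vqpForm`) is a CHARACTERISATION claim: under it, for p-families,
  `NQP f ↔ (f matrix-symmetric ∧ IsVQPFamily f ∧ f narrow of some length)`.  The `-3` hands' substitution
  principle (`FormulaSubstitution`, `NarrowPostComposition`: NQP ∘ VQP ⊆ NQP) already works at `VQP` scale, so
  nothing in the strata programme is lost by passing to the `VQP` form.

Honest label: bookkeeping around an existing bridge; no stub of the line is closed (stub 1 is refuted as
registered, stub 2 is the open aside); `OrbitCompressionQP`, the route and VP ≠ VNP are NOT moved.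
References: Bürgisser 2000, Def. 2.26 (VQP), Rem. 2.7; Dawar–Wilsenach 2025, Def. 2.2;
Dawar–Pago–Seppelt 2025 §5; Dwivedi–Pago–Seppelt 2026 §1.
-/

-- `Summit.ValiantsHypothesis.ValiantsHypothesis.…` is the tree's single-conjunct layout (Sub = Summit).
set_option linter.dupNamespace false

noncomputable section

namespace Summit.ValiantsHypothesis.ValiantsHypothesis.Theorems.SymmetricSizeVQP

open Literature.Computability.AlgebraicComplexity
open Summit.ValiantsHypothesis.ValiantsHypothesis.Theses.MonotoneRestoration

/-! ### Quasi-polynomial size forces quasi-polynomial complexity -/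

/-- A family computed level by level by labelled (unbounded fan-in, DAG) circuits with at most
`2^((log₂ n + c)^c)` gates has quasi-polynomially bounded fan-in-two complexity: the tree's bridge
`SymmetryDialPlumbing.complexity_eval_le` gives `complexity (f n) ≤ |G|²`, and squares of quasi-polynomial
bounds are quasi-polynomial (`IsQPBounded.pow`).  No symmetry is needed. [cite: Burgisser2000, Rem. 2.7] -/
theorem isQPBounded_complexity_of_qpSize (f : (n : ℕ) → MvPolynomial (Fin n × Fin n) ℂ)
    (h : ∃ c : ℕ, ∀ n : ℕ, ∃ (G : Type) (_ : Fintype G)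
        (C : LabelledArithCircuit ℂ (Fin n × Fin n) Unit G),
      C.eval (C.output ()) = f n ∧ Fintype.card G ≤ 2 ^ ((Nat.log 2 n + c) ^ c)) :
    IsQPBounded fun n => complexity (f n) := by
  obtain ⟨c, hc⟩ := h
  have hqp : IsQPBounded fun n => 2 ^ ((Nat.log 2 n + c) ^ c) := ⟨c, fun n => le_rfl⟩
  refine (IsQPBounded.pow hqp 2).mono fun n => ?_
  obtain ⟨G, _, C, hev, hcard⟩ := hc n
  show complexity (f n) ≤ (2 ^ ((Nat.log 2 n + c) ^ c)) ^ 2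
  rw [← hev]
  exact (SymmetryDialPlumbing.complexity_eval_le C (C.output ())).trans
    (Nat.pow_le_pow_left hcard 2)

/-- **The conclusion of `OrbitCompressionQP` forces quasi-polynomial complexity**: square-symmetric
labelled circuits of quasi-polynomial SIZE for `f n` (the crux's conclusion, verbatim) give
`IsQPBounded (fun n => complexity (f n))`. [cite: Burgisser2000, Def. 2.26] -/
theorem isQPBounded_complexity_of_qpSymmetricSize (f : (n : ℕ) → MvPolynomial (Fin n × Fin n) ℂ)
    (h : ∃ c : ℕ, ∀ n : ℕ, ∃ (G : Type) (_ : Fintype G)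
        (C : LabelledArithCircuit ℂ (Fin n × Fin n) Unit G),
      C.IsSymmetric (Equiv.Perm (Fin n)) ∧ C.eval (C.output ()) = f n ∧
        Fintype.card G ≤ 2 ^ ((Nat.log 2 n + c) ^ c)) :
    IsQPBounded fun n => complexity (f n) := by
  obtain ⟨c, hc⟩ := h
  refine isQPBounded_complexity_of_qpSize f ⟨c, fun n => ?_⟩
  obtain ⟨G, hG, C, -, hev, hcard⟩ := hc n
  exact ⟨G, hG, C, hev, hcard⟩

/-- Hence a p-family (p-bounded number of variables — automatic here — and degree) with square-symmetric
circuits of quasi-polynomial size is a `VQP` family. [cite: Burgisser2000, Def. 2.26] -/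
theorem isVQPFamily_of_qpSymmetricSize (f : (n : ℕ) → MvPolynomial (Fin n × Fin n) ℂ)
    (hPF : IsPFamily f)
    (h : ∃ c : ℕ, ∀ n : ℕ, ∃ (G : Type) (_ : Fintype G)
        (C : LabelledArithCircuit ℂ (Fin n × Fin n) Unit G),
      C.IsSymmetric (Equiv.Perm (Fin n)) ∧ C.eval (C.output ()) = f n ∧
        Fintype.card G ≤ 2 ^ ((Nat.log 2 n + c) ^ c)) :
    IsVQPFamily f :=
  ⟨hPF, isQPBounded_complexity_of_qpSymmetricSize f h⟩

/-! ### NQP ⊆ VQP -/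

/-- **NQP families have quasi-polynomially bounded complexity.**  If `f n` is, for every `n ≥ 1`, the
closed polynomial of a labelled pattern expression with `n^(k+l) ≤ 2^((log₂ n + c)^c)` and length
`≤ 2^((log₂ n + c)^c)` (the conclusion of `stub_narrowExpressionCompression`), then THEOREM ζ-P
(`Theorems.qpSymmetric_patternExpr`) supplies square-symmetric circuits of quasi-polynomial size and the
bridge bounds the complexity. [cite: DawarPagoSeppelt2025, §5] -/
theorem isQPBounded_complexity_of_narrowQP (f : (n : ℕ) → MvPolynomial (Fin n × Fin n) ℂ)
    (h : ∃ c : ℕ, ∀ n : ℕ, 1 ≤ n → ∃ (k l : ℕ) (e : PatternExpr ℂ k l),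
      n ^ (k + l) ≤ 2 ^ ((Nat.log 2 n + c) ^ c) ∧ e.length ≤ 2 ^ ((Nat.log 2 n + c) ^ c) ∧
        e.close n = f n) :
    IsQPBounded fun n => complexity (f n) :=
  isQPBounded_complexity_of_qpSymmetricSize f (Theorems.qpSymmetric_patternExpr f h)

/-- **NQP ⊆ VQP** for p-families: a family of p-bounded degree presented by narrow expressions of
quasi-polynomial length is a `VQP` family. [cite: Burgisser2000, Def. 2.26] -/
theorem isVQPFamily_of_narrowQP (f : (n : ℕ) → MvPolynomial (Fin n × Fin n) ℂ) (hPF : IsPFamily f)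
    (h : ∃ c : ℕ, ∀ n : ℕ, 1 ≤ n → ∃ (k l : ℕ) (e : PatternExpr ℂ k l),
      n ^ (k + l) ≤ 2 ^ ((Nat.log 2 n + c) ^ c) ∧ e.length ≤ 2 ^ ((Nat.log 2 n + c) ^ c) ∧
        e.close n = f n) :
    IsVQPFamily f :=
  ⟨hPF, isQPBounded_complexity_of_narrowQP f h⟩

/-- NQP families are matrix-symmetric (closed pattern expressions are invariant under independent row
and column permutations, `PatternExpr.rename_perm_close`; the level `n = 0` has no variables).
[cite: DwivediPagoSeppelt2026, §1 (eq. (1))] -/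
theorem matrixSymmetric_of_narrowQP (f : (n : ℕ) → MvPolynomial (Fin n × Fin n) ℂ)
    (h : ∃ c : ℕ, ∀ n : ℕ, 1 ≤ n → ∃ (k l : ℕ) (e : PatternExpr ℂ k l),
      n ^ (k + l) ≤ 2 ^ ((Nat.log 2 n + c) ^ c) ∧ e.length ≤ 2 ^ ((Nat.log 2 n + c) ^ c) ∧
        e.close n = f n) :
    ∀ (n : ℕ) (σ τ : Equiv.Perm (Fin n)),
      MvPolynomial.rename (fun p : Fin n × Fin n => (σ p.1, τ p.2)) (f n) = f n := by
  obtain ⟨c, hc⟩ := h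
  intro n σ τ
  rcases Nat.eq_zero_or_pos n with rfl | hn
  · have hid : (fun p : Fin 0 × Fin 0 => (σ p.1, τ p.2)) = id := funext fun p => p.1.elim0
    rw [hid, MvPolynomial.rename_id, AlgHom.id_apply]
  · obtain ⟨k, l, e, -, -, he⟩ := hc n hn
    rw [← he]
    exact PatternExpr.rename_perm_close n σ τ e

/-- NQP families are narrow of some length (drop the length bound). [folklore] -/
theorem narrow_of_narrowQP (f : (n : ℕ) → MvPolynomial (Fin n × Fin n) ℂ)
    (h : ∃ c : ℕ, ∀ n : ℕ, 1 ≤ n → ∃ (k l : ℕ) (e : PatternExpr ℂ k l),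
      n ^ (k + l) ≤ 2 ^ ((Nat.log 2 n + c) ^ c) ∧ e.length ≤ 2 ^ ((Nat.log 2 n + c) ^ c) ∧
        e.close n = f n) :
    ∃ c : ℕ, ∀ n : ℕ, 1 ≤ n → ∃ (k l : ℕ) (e : PatternExpr ℂ k l),
      n ^ (k + l) ≤ 2 ^ ((Nat.log 2 n + c) ^ c) ∧ e.close n = f n := by
  obtain ⟨c, hc⟩ := h
  refine ⟨c, fun n hn => ?_⟩
  obtain ⟨k, l, e, hkl, -, he⟩ := hc n hn
  exact ⟨k, l, e, hkl, he⟩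

/-! ### The `VQP` form of the open stub is a characterisation claim -/

/-- The `VQP` form of `stub_narrowExpressionCompression` ("matrix-symmetric `VQP` families with narrow
expressions of some length are NQP") implies the registered stub (`VP ⊆ VQP`,
`IsVPFamily.isVQPFamily`). [cite: Burgisser2000, Def. 2.26] -/
theorem stub_narrowExpressionCompression_of_vqpForm
    (H : ∀ f : (n : ℕ) → MvPolynomial (Fin n × Fin n) ℂ,
      (∀ (n : ℕ) (σ τ : Equiv.Perm (Fin n)),
        MvPolynomial.rename (fun p : Fin n × Fin n => (σ p.1, τ p.2)) (f n) = f n) →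
      IsVQPFamily f →
      (∃ c : ℕ, ∀ n : ℕ, 1 ≤ n → ∃ (k l : ℕ) (e : PatternExpr ℂ k l),
        n ^ (k + l) ≤ 2 ^ ((Nat.log 2 n + c) ^ c) ∧ e.close n = f n) →
      ∃ c : ℕ, ∀ n : ℕ, 1 ≤ n → ∃ (k l : ℕ) (e : PatternExpr ℂ k l),
        n ^ (k + l) ≤ 2 ^ ((Nat.log 2 n + c) ^ c) ∧ e.length ≤ 2 ^ ((Nat.log 2 n + c) ^ c) ∧
        e.close n = f n) :
    ∀ f : (n : ℕ) → MvPolynomial (Fin n × Fin n) ℂ,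
      (∀ (n : ℕ) (σ τ : Equiv.Perm (Fin n)),
        MvPolynomial.rename (fun p : Fin n × Fin n => (σ p.1, τ p.2)) (f n) = f n) →
      IsVPFamily f →
      (∃ c : ℕ, ∀ n : ℕ, 1 ≤ n → ∃ (k l : ℕ) (e : PatternExpr ℂ k l),
        n ^ (k + l) ≤ 2 ^ ((Nat.log 2 n + c) ^ c) ∧ e.close n = f n) →
      ∃ c : ℕ, ∀ n : ℕ, 1 ≤ n → ∃ (k l : ℕ) (e : PatternExpr ℂ k l),
        n ^ (k + l) ≤ 2 ^ ((Nat.log 2 n + c) ^ c) ∧ e.length ≤ 2 ^ ((Nat.log 2 n + c) ^ c) ∧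
        e.close n = f n :=
  fun f hsymm hVP hnarrow => H f hsymm hVP.isVQPFamily hnarrow

/-- **Under the `VQP` form of the stub, NQP is CHARACTERISED** (for p-families): `f` is NQP iff it is
matrix-symmetric, `VQP`, and narrow of some length — the forward implications are the theorems above,
the backward one is the hypothesis. [cite: DawarPagoSeppelt2025, §5] -/
theorem narrowQP_iff_of_vqpCompression
    (H : ∀ f : (n : ℕ) → MvPolynomial (Fin n × Fin n) ℂ,
      (∀ (n : ℕ) (σ τ : Equiv.Perm (Fin n)),
        MvPolynomial.rename (fun p : Fin n × Fin n => (σ p.1, τ p.2)) (f n) = f n) →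
      IsVQPFamily f →
      (∃ c : ℕ, ∀ n : ℕ, 1 ≤ n → ∃ (k l : ℕ) (e : PatternExpr ℂ k l),
        n ^ (k + l) ≤ 2 ^ ((Nat.log 2 n + c) ^ c) ∧ e.close n = f n) →
      ∃ c : ℕ, ∀ n : ℕ, 1 ≤ n → ∃ (k l : ℕ) (e : PatternExpr ℂ k l),
        n ^ (k + l) ≤ 2 ^ ((Nat.log 2 n + c) ^ c) ∧ e.length ≤ 2 ^ ((Nat.log 2 n + c) ^ c) ∧
        e.close n = f n)
    (f : (n : ℕ) → MvPolynomial (Fin n × Fin n) ℂ) (hPF : IsPFamily f) :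
    (∃ c : ℕ, ∀ n : ℕ, 1 ≤ n → ∃ (k l : ℕ) (e : PatternExpr ℂ k l),
        n ^ (k + l) ≤ 2 ^ ((Nat.log 2 n + c) ^ c) ∧ e.length ≤ 2 ^ ((Nat.log 2 n + c) ^ c) ∧
        e.close n = f n) ↔
      ((∀ (n : ℕ) (σ τ : Equiv.Perm (Fin n)),
          MvPolynomial.rename (fun p : Fin n × Fin n => (σ p.1, τ p.2)) (f n) = f n) ∧
        IsVQPFamily f ∧
        ∃ c : ℕ, ∀ n : ℕ, 1 ≤ n → ∃ (k l : ℕ) (e : PatternExpr ℂ k l),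
          n ^ (k + l) ≤ 2 ^ ((Nat.log 2 n + c) ^ c) ∧ e.close n = f n) :=
  ⟨fun h => ⟨matrixSymmetric_of_narrowQP f h, isVQPFamily_of_narrowQP f hPF h, narrow_of_narrowQP f h⟩,
    fun h => H f h.1 h.2.1 h.2.2⟩

end Summit.ValiantsHypothesis.ValiantsHypothesis.Theorems.SymmetricSizeVQP

end
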